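import Summits.Parity.GeneralizedHardyLittlewood.Theorems.ModelHyperbolicity.Negative.ModelHyperbolicityLoadBearing
import Summits.Parity.GeneralizedHardyLittlewood.Theorems.ModelHyperbolicity.Negative.ModelHyperbolicityUniformFalse
import HarnessLib

/-!
# Line `window-chain-transport` — LEAD-OWNED skeleton for crux `LeeYangFibres.ModelHyperbolicity`
# (stmt-Parity-14110, route-Parity-LeeYangFibres, rank 4) — reshaped by the line lead (7 registered stubs:
# calculus | windowChain(+noNullWindow) | simpleZeros | transfer | cellRate | cellLimit | glue)

Crux (verbatim, factored as in the landed Negative file, `Negative.crux_iff`):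
`∀ u ≥ 2, ∃ x₀, ∀ x ≥ x₀, RealRootedAt u x` — the rough-integer cell polynomial
`P_{u,x}(z) = Σ_{j ≤ u} A_j(x) z^j`, `A_j(x) = #{n ≤ x : x^{1/u} < P⁻(n), Ω(n) = j}`, has only real zeros.

**Lever** (planner's line card `Lines/window-chain-transport.md`, re-derived by the lead): with the Alladi–Buchstab
densities `I_1 = 1`, `I_{j+1}(u) = ∫_1^{max(u-1,1)} I_j(t) dt/t` and `G_N(t;z) = Σ_{j<N} I_{j+1}(t) z^j`, the delay
equation in VOLTERRA form `G(s) − G(σ) = z ∫_{max(σ−1,1)}^{max(s−1,1)} G(τ) dτ/τ` transports the Hermite–Biehler pair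
`PP(τ,t): Im(G(t)/G(τ)) ≥ 0`, `SPP(τ,t): Im(z G(τ)/G(t)) > 0` (`1 ≤ τ ≤ t ≤ τ+1`, `Im z > 0`) across INTEGER windows by
linearity of `Im` under the integral (`stub_windowChain`); a multiple real zero of `G(u;·)` would force a NULL WINDOW
(`stub_simpleZeros`), which the delay equation propagates down to `[1,2]` where `G ≡ 1` (`stub_noNullWindow`); so
`modelPoly u` has `u − 2` simple real zeros; Alladi's cell asymptotics (`stub_cellRate` in the tree's `(X,Y)` rate
format + `stub_cellLimit`) and the landed sign-alternation transfer (`stub_transfer`) give the crux per integer `u`.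

**Reshaping by the lead (vs the planner's 5 stubs).** (i) The calculus of the densities / model family that EVERY
model-side stub needs (continuity, vanishing, positivity, FTC, Volterra identity) is ONE registered stub
`stub_calculus : DensityCalculus`, taken as an explicit hypothesis by `stub_windowChain`, `stub_simpleZeros`,
`stub_cellLimit` (no duplicated lemmas across workers, no shared-file race); the planner's `stub_windowChain` and
`stub_noNullWindow` (same toolkit: the Volterra identity) are ONE stub with a conjunction. (ii) The planner's
`stub_cellAsymptotics` (L) is split into `stub_cellRate : DensityCalculus → CellRate` (Alladi WITH RATE in the `(X, Y)`-format of
`Literature.NumberTheory.Sieve.exists_abs_card_roughIcc_sub_main_le` — the labour, held by the lead) and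
`stub_cellLimit : CellLimitStep` (rate ⇒ limit at `Y = ⌊x^{1/u}⌋₊ + 1`). (iii) The pure-logic composition is the
registered bookkeeping stub `stub_glue`, PROVED in the vocabulary file (through which that file lands `--supports`):
`transfer u (simpleZeros calc wc.1 wc.2 u) (cellLimit calc cellRate u)`.

**Objects** (§0) are byte-identical with the lead's vocabulary file `Theorems/LeeYangFibresModelHyperbolicityDefs.lean`
(proposed `--supports stmt-Parity-14110`); once it lands, §0 is replaced by its import (same namespace, same names,
so every registered signature is textually unchanged).

**Disproof used** (`Cruxes/ModelHyperbolicity/Disproof.lean`, gen-2, rc0, 0 sorry, re-read by the lead 2026-08-16;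
landed parts imported here): `modelHyperbolicity_false_without_largeX` — "large `x`" enters only at `stub_transfer`
(`∃ x₀(u)` from the limits); `modelHyperbolicity_false_without_two_le` — `2 ≤ u` threaded through `SimpleZerosStep`,
`CellLimitStep`, `TransferStep`; `not_modelHyperbolicityUniform` — no stub is uniform in `u`; `not_monotone_in_x` — the
transfer is eventual, never monotone. No `-- Targets` section exists yet. No stub is an instance of a landed Negative lemma.
-/

noncomputable section

namespace Summit.Parity.GeneralizedHardyLittlewood.Cruxes.ModelHyperbolicity.WindowChainTransport

open scoped BigOperators
open Polynomial Filter
open Summit.Parity.GeneralizedHardyLittlewood.Theses.LeeYangFibres (ModelHyperbolicity)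
open Summit.Parity.GeneralizedHardyLittlewood.Theorems.ModelHyperbolicity.Negative
  (cell cellPoly RealRootedAt crux_iff ModelHyperbolicityWithoutLargeX ModelHyperbolicityWithoutTwoLe
    ModelHyperbolicityUniform modelHyperbolicity_false_without_largeX modelHyperbolicity_false_without_two_le
    not_modelHyperbolicityUniform)

/-! ## §0 Objects and statements — VERBATIM the vocabulary file `Theorems/LeeYangFibresModelHyperbolicityDefs.lean`
(delete this section and `import` that file once it has landed) -/

/-! ## Objects -/

/-- **Alladi–Buchstab cell densities**, index-shifted: `cellDensity j u = I_{j+1}(u)`, with `I_1 ≡ 1`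
and `I_{j+2}(u) = ∫_1^{max(u-1,1)} I_{j+1}(t) dt/t`. -/
def cellDensity : ℕ → ℝ → ℝ
  | 0, _ => 1
  | j + 1, u => ∫ t in (1 : ℝ)..max (u - 1) 1, cellDensity j t / t

/-- **The model polynomial family, evaluated**: `modelEval N u z = Σ_{j<N} I_{j+1}(u) z^j`. -/
def modelEval (N : ℕ) (u : ℝ) (z : ℂ) : ℂ :=
  ∑ j ∈ Finset.range N, (cellDensity j u : ℂ) * z ^ j

/-- **The real model polynomial at integer roughness** `u`: `Σ_{j<u} I_{j+1}(u) X^j ∈ ℝ[X]`. -/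
def modelPoly (u : ℕ) : ℝ[X] :=
  ∑ j ∈ Finset.range u, C (cellDensity j u) * X ^ j

/-- **Ω-cells of the rough integers with an integer threshold**:
`omegaCell N X j = #{1 ≤ n ≤ X : N ≤ P⁻(n), Ω(n) = j}` (`P⁻ = Nat.minFac`, `Ω = cardFactors`;
`n = 1` has `P⁻(1) = 1`, `Ω(1) = 0`). -/
def omegaCell (N X j : ℕ) : ℕ :=
  ((Finset.Icc 1 X).filter (fun n => N ≤ Nat.minFac n ∧ ArithmeticFunction.cardFactors n = j)).card

/-! ## Statements (types of the registered stubs and their hypothesis bundles) -/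

/-- **The calculus of the densities and of the model family** (type of `stub_calculus`; hypothesis of
most other stubs): (C1) every `cellDensity j` is continuous on `ℝ`; (C2) `I_{j+2}(u) = 0` for
`u ≤ j+2`; (C3) `I_{j+1}(u) > 0` for `u > j+1`; (C4) FTC: `I_{j+2}'(u) = I_{j+1}(u-1)/(u-1)` for `u > 2`;
(C5) `τ ↦ G_N(τ;z)` is continuous; (C6) the delay equation
`∂_τ G_N(τ;z) = z·G_N(τ-1;z)/(τ-1)` for `2 < τ ≤ N+1`, `N ≥ 2`; (C7) its VOLTERRA form
`G_N(s;z) − G_N(σ;z) = z ∫_{max(σ-1,1)}^{max(s-1,1)} G_N(τ;z) dτ/τ` for `1 ≤ σ ≤ s ≤ N+1`, `N ≥ 2`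
(in (C6)–(C7) the would-be top term vanishes by (C2); both FAIL at `N = 1`, where `G_1 ≡ 1`). -/
def DensityCalculus : Prop :=
  (∀ j : ℕ, Continuous (cellDensity j)) ∧
  (∀ j : ℕ, ∀ u : ℝ, u ≤ (j : ℝ) + 2 → cellDensity (j + 1) u = 0) ∧
  (∀ j : ℕ, ∀ u : ℝ, (j : ℝ) + 1 < u → 0 < cellDensity j u) ∧
  (∀ j : ℕ, ∀ u : ℝ, 2 < u → HasDerivAt (cellDensity (j + 1)) (cellDensity j (u - 1) / (u - 1)) u) ∧
  (∀ N : ℕ, ∀ z : ℂ, Continuous (fun τ : ℝ => modelEval N τ z)) ∧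
  (∀ N : ℕ, 2 ≤ N → ∀ z : ℂ, ∀ τ : ℝ, 2 < τ → τ ≤ (N : ℝ) + 1 →
    HasDerivAt (fun t : ℝ => modelEval N t z) (z * modelEval N (τ - 1) z / ((τ : ℂ) - 1)) τ) ∧
  (∀ N : ℕ, 2 ≤ N → ∀ z : ℂ, ∀ σ s : ℝ, 1 ≤ σ → σ ≤ s → s ≤ (N : ℝ) + 1 →
    modelEval N s z - modelEval N σ z =
      z * ∫ τ in max (σ - 1) 1..max (s - 1) 1, modelEval N τ z / (τ : ℂ))

/-- **THE INVARIANT — the unit window is a chain (Hermite–Biehler positivity pair).** For all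
`1 ≤ τ ≤ t ≤ τ + 1` with `t ≤ N` and all `z` in the open upper half-plane: `G_N(τ;z), G_N(t;z) ≠ 0`,
`Im(G_N(t;z)/G_N(τ;z)) ≥ 0` (weak proper position `G(τ) ≼ G(t)`) and `Im(z·G_N(τ;z)/G_N(t;z)) > 0`
(strict: `G(t) ≺ z·G(τ)`). Sharp: span `1` holds, span `1.25` fails numerically. -/
def WindowChain (N : ℕ) : Prop :=
  ∀ τ t : ℝ, 1 ≤ τ → τ ≤ t → t ≤ τ + 1 → t ≤ (N : ℝ) → ∀ z : ℂ, 0 < z.im →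
    modelEval N τ z ≠ 0 ∧ modelEval N t z ≠ 0 ∧
      0 ≤ (modelEval N t z / modelEval N τ z).im ∧ 0 < (z * modelEval N τ z / modelEval N t z).im

/-- **No null window** (backward uniqueness for the delay equation): for `z ≠ 0`, `τ ↦ G_N(τ;z)`
cannot vanish on a whole unit window `[a, a+1] ⊆ [1, N]`. -/
def NoNullWindow : Prop :=
  ∀ N : ℕ, ∀ z : ℂ, z ≠ 0 → ∀ a : ℝ, 1 ≤ a → a + 1 ≤ (N : ℝ) →
    ∃ τ ∈ Set.Icc a (a + 1), modelEval N τ z ≠ 0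

/-- **Model simplicity at integer `u`**: `modelPoly u` has degree `≤ u - 2` and at least `u - 2`
DISTINCT real roots (so exactly `u - 2` simple real zeros and nothing else). -/
def ModelSimple (u : ℕ) : Prop :=
  (modelPoly u).natDegree ≤ u - 2 ∧ u - 2 ≤ (modelPoly u).roots.toFinset.card

/-- The SIMPLICITY step (type of `stub_simpleZeros`). -/
def SimpleZerosStep : Prop :=
  DensityCalculus → (∀ N : ℕ, WindowChain N) → NoNullWindow → ∀ u : ℕ, 2 ≤ u → ModelSimple u

/-- **Alladi's cell asymptotics WITH RATE, in the tree's `(X, Y)`-format** (type of `stub_cellRate`):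
for every `j, k` there is `C` such that for all real `2 ≤ Y ≤ X` with `log X ≤ k·log Y`,
`|#{n ≤ X : P⁻(n) ≥ Y, Ω(n) = j+1} − (X·I_{j+1}(log X/log Y)/log X − [j = 0]·Y/log Y)| ≤ C·X/log² Y`
(`j = 0`: the prime number theorem with de la Vallée Poussin's error; `j ≥ 1`: induction over
Buchstab's identity by the least prime factor, Abel summation through `ϑ`, and
`(v·σ)' = …`-type integral identities of the densities — the `Ω`-split of the tree's
`Literature.NumberTheory.Sieve.exists_abs_card_roughIcc_sub_main_le`; Alladi 1982, Tenenbaum III.6).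
A statement (registered stub type), not a fact. -/
def CellRate : Prop :=
  ∀ j k : ℕ, ∃ C : ℝ, ∀ X Y : ℝ, 2 ≤ Y → Y ≤ X → Real.log X ≤ k * Real.log Y →
    |(omegaCell ⌈Y⌉₊ ⌊X⌋₊ (j + 1) : ℝ) -
        (X * cellDensity j (Real.log X / Real.log Y) / Real.log X - if j = 0 then Y / Real.log Y else 0)| ≤
      C * X / Real.log Y ^ 2

/-- **Alladi's cell asymptotics at integer roughness `u`, limit form**:
`A_{j+1}(x)·log x/x → I_{j+1}(u)` as `x → ∞` through `ℕ`, for every `j`. -/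
def CellAsymptotics (u : ℕ) : Prop :=
  ∀ j : ℕ, Tendsto (fun x : ℕ => (cell u x (j + 1) : ℝ) * Real.log x / x) atTop
    (nhds (cellDensity j u))

/-- The LIMIT step (type of `stub_cellLimit`): rate form ⇒ limit form at every integer `u ≥ 2`
(apply `CellRate` at `Y = ⌊x^{1/u}⌋₊ + 1`, `X = x`, `k = u + 1`; continuity of `I_{j+1}` at `u`). -/
def CellLimitStep : Prop :=
  DensityCalculus → CellRate → ∀ u : ℕ, 2 ≤ u → CellAsymptotics u

/-- The FINITE-`x` TRANSFER (type of `stub_transfer`): `u - 2` simple real model zeros + cell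
asymptotics ⇒ the reduced cell polynomial alternates in sign at `u - 1` fixed points for `x ≥ x₀(u)`
⇒ `RealRootedAt u x` (landed `Negative.realRootedAt_of_alternating`). -/
def TransferStep : Prop :=
  ∀ u : ℕ, 2 ≤ u → ModelSimple u → CellAsymptotics u → ∃ x₀ : ℕ, ∀ x : ℕ, x₀ ≤ x → RealRootedAt u x

/-! ## Small sorry-free API -/

/-- `I_1 ≡ 1`. -/
@[simp] theorem cellDensity_zero (u : ℝ) : cellDensity 0 u = 1 := by
  simp [cellDensity]

/-- Above index `0` the densities vanish on `u ≤ 2` (the integral runs over `[1,1]`). -/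
theorem cellDensity_succ_of_le_two (j : ℕ) {u : ℝ} (hu : u ≤ 2) : cellDensity (j + 1) u = 0 := by
  have h : max (u - 1) 1 = 1 := max_eq_right (by linarith)
  simp [cellDensity, h]

/-- On the base window `u ≤ 2` the model polynomial is the constant `1` (any truncation `N ≥ 1`). -/
theorem modelEval_of_le_two {N : ℕ} (hN : 1 ≤ N) {u : ℝ} (hu : u ≤ 2) (z : ℂ) : modelEval N u z = 1 := by
  unfold modelEval
  obtain ⟨M, rfl⟩ : ∃ M, N = M + 1 := ⟨N - 1, by omega⟩
  rw [Finset.sum_range_succ']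
  simp [cellDensity_succ_of_le_two _ hu]

/-- The constant coefficient of the model family is `I_1 = 1`: `G_N(u;0) = 1`. -/
theorem modelEval_zero_right {N : ℕ} (hN : 1 ≤ N) (u : ℝ) : modelEval N u 0 = 1 := by
  unfold modelEval
  obtain ⟨M, rfl⟩ : ∃ M, N = M + 1 := ⟨N - 1, by omega⟩
  rw [Finset.sum_range_succ']
  simp

/-- Coefficients of `modelPoly u`: `I_{i+1}(u)` for `i < u`. -/
theorem modelPoly_coeff (u i : ℕ) :
    (modelPoly u).coeff i = if i < u then cellDensity i u else 0 := by
  unfold modelPoly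
  rw [finsetSum_coeff]
  simp only [coeff_C_mul_X_pow]
  rw [Finset.sum_ite_eq]
  simp [Finset.mem_range]

/-- Real evaluation of `modelPoly u`. -/
theorem modelPoly_eval (u : ℕ) (t : ℝ) :
    (modelPoly u).eval t = ∑ j ∈ Finset.range u, cellDensity j u * t ^ j := by
  unfold modelPoly
  rw [eval_finsetSum]
  simp only [eval_mul, eval_C, eval_pow, eval_X]

/-- `modelPoly u` pushed to `ℂ` evaluates to `modelEval u u`. -/
theorem modelPoly_map_eval (u : ℕ) (z : ℂ) :
    ((modelPoly u).map (algebraMap ℝ ℂ)).eval z = modelEval u u z := by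
  unfold modelPoly modelEval
  rw [Polynomial.map_sum, eval_finsetSum]
  simp only [Polynomial.map_mul, Polynomial.map_C, Polynomial.map_pow, Polynomial.map_X, eval_mul, eval_C,
    eval_pow, eval_X, Complex.coe_algebraMap]

/-- The finite-`x` cells of the crux are Ω-cells with the integer threshold `⌊x^{1/u}⌋₊ + 1`:
`x^{1/u} < P⁻(n) ↔ ⌊x^{1/u}⌋₊ + 1 ≤ P⁻(n)`. -/
theorem cell_eq_omegaCell (u x j : ℕ) : cell u x j = omegaCell (⌊(x : ℝ) ^ ((1 : ℝ) / u)⌋₊ + 1) x j := by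
  unfold cell omegaCell
  congr 1
  refine Finset.filter_congr fun n _ => ?_
  have h0 : (0 : ℝ) ≤ (x : ℝ) ^ ((1 : ℝ) / u) := by positivity
  rw [Nat.add_one_le_iff, Nat.floor_lt h0]


/-! ## §1 The seven registered stubs (the ONLY sorries of this file) -/

/-- **Stub A — the calculus of the densities and of the model family.** `DensityCalculus` (C1)–(C7): continuity of
every `cellDensity j` (induction: `j = 0` constant; `j+1`: a primitive over `[1, w]` composed with `w = max(u-1,1)`,
for `j ≥ 1` the integrand `t ↦ I_{j+1}(t)/t` is globally continuous since it vanishes on `t ≤ 2`, for `j = 0` use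
`log(max(u-1,1))`); vanishing `I_{j+2}(u) = 0` for `u ≤ j+2` and positivity beyond (induction, split the integral at
`j+1`); FTC `intervalIntegral.integral_hasDerivAt_right` at `u > 2` (where `max(u-1,1) = u-1` locally); the model
family: continuity, `HasDerivAt` in `τ` (finite sum of (C4) via `HasDerivAt.ofReal_comp`, top term killed by (C2)),
and the Volterra identity (difference of the defining integrals, `intervalIntegral.integral_finset_sum`). Size M.
Template: `Literature/NumberTheory/Sieve/BuchstabFunction.lean` (`hasDerivAt_mul_buchstabOmega`,
`mul_buchstabOmega_eq_one_add_integral`). -/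
theorem stub_calculus : DensityCalculus := by
  sorry

/-- **Stub B — THE LEVER: the unit window is a chain, transported by the Volterra identity; and NO NULL WINDOW.**
`DensityCalculus → (∀ N, WindowChain N) ∧ NoNullWindow`.
(B1, the chain) For fixed `N` (vacuous for `N = 0`; `G_1 ≡ 1` for `N = 1`; else) induction on the integer
`k ∈ [2, N]` of `W(k)`: the four conjuncts for all `1 ≤ τ ≤ t ≤ min(τ+1, k)`. Base `k = 2`: `modelEval_of_le_two`.
Step `k → k+1`: FIRST pairs `σ ≤ k < s ≤ min(k+1, σ+1)`: by (C7)
`G(s)/G(σ) = 1 + ∫_{max(σ−1,1)}^{s−1} [z·G(τ)/G(σ)] dτ/τ`, every integrand has `Im > 0` by `SPP(τ,σ)` (`σ−1 ≤ τ ≤ σ ≤ k`,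
hypothesis `W(k)`; `Im ∫ = ∫ Im`: `intervalIntegral.integral_im` / `ContinuousLinearMap.intervalIntegral_comp_comm`), so
`Im(G(s)/G(σ)) ≥ 0`; and `G(s)/(z G(σ)) = 1/z + ∫ [G(τ)/G(σ)] dτ/τ` has `Im ≤ Im(1/z) < 0` since `Im(G(τ)/G(σ)) =
−Im(G(σ)/G(τ))/|…|² ≤ 0` by `PP(τ,σ)`; hence `G(s) ≠ 0` and `Im(z G(σ)/G(s)) > 0`. THEN pairs `k < σ ≤ s ≤ k+1` by the same
two formulas, whose integrands involve only first-kind pairs `(τ, σ)`, `τ ≤ s−1 ≤ k < σ ≤ τ+1`.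
(B2, no null window — backward uniqueness for the delay equation) If `G_N(·;z) ≡ 0` on `[a, a+1]` with `1 ≤ a`,
`a+1 ≤ N`, `z ≠ 0`: when `a ≤ 2`, `G_N(a;z) = 1` — contradiction; when `a > 2`, by (C7) all integrals
`∫_{σ−1}^{s−1} G_N(τ)dτ/τ` (`a ≤ σ ≤ s ≤ a+1`) vanish, so the continuous `G_N` vanishes on `[a−1, a]` (or: by (C6) the
derivative `z G_N(τ−1)/(τ−1)` of the zero function vanishes on `(a, a+1)`): a null window one unit lower; induction on
`⌊a⌋₊`. Size M–L. -/
theorem stub_windowChain : DensityCalculus → (∀ N : ℕ, WindowChain N) ∧ NoNullWindow := by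
  sorry

/-- **Stub D — simplicity from the chain (the squeeze).** `SimpleZerosStep`. For `u ≥ 2` (`u = 2`: `modelPoly 2 = 1`,
both sides `0`): (a) `modelPoly_map_eval`: the `ℂ`-map of `modelPoly u` evaluates to `modelEval u u`; (b)
`natDegree (modelPoly u) = u − 2` (`modelPoly_coeff`, (C2) `I_u(u) = 0`, (C3) `I_{u−1}(u) > 0`); (c) REALITY:
`WindowChain u` at `(τ,t) = (u,u)` gives `modelEval u u z ≠ 0` on `Im z > 0`, conjugation (real coefficients) gives
`Im z < 0`, so every complex root is real and `(modelPoly u).roots.card = natDegree` (induction on the degree, splitting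
off one real root at a time, or `roots_map` bookkeeping); (d) DISTINCTNESS: a real root `t₀` of multiplicity `m ≥ 2`
has `t₀ ≠ 0` (`modelEval_zero_right`); write `modelPoly u = (X − t₀)^m · q`, `q(t₀) ≠ 0`
(`Polynomial.pow_mul_divByMonic_rootMultiplicity_eq`, `eval_divByMonic_pow_rootMultiplicity_ne_zero`); for `τ ∈ [u−1,u]`
with `G(τ;t₀) ≠ 0`, along `z_r = t₀ + r e^{iθ}` one has `r^m · z_r G(τ;z_r)/G(u;z_r) → t₀ G(τ;t₀) e^{−imθ}/q(t₀) =: d e^{−imθ}`,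
`d ∈ ℝ∖{0}`; choose `θ = π/(2m)` if `d > 0`, `θ = 3π/(2m)` if `d < 0` (`θ ∈ (0,π)` as `m ≥ 2`) so that `Im(d e^{−imθ}) < 0`;
then for small `r > 0`, `Im(z_r G(τ;z_r)/G(u;z_r)) < 0` with `Im z_r > 0`, contradicting `SPP(τ,u)` of `WindowChain u`;
hence `G(τ;t₀) = 0` on the whole window `[u−1,u]`, contradicting `NoNullWindow` (`N = u`, `a = u−1 ≥ 1`, `z = t₀ ≠ 0`).
So `roots.Nodup` and `roots.toFinset.card = natDegree = u − 2`. Size M–L. -/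
theorem stub_simpleZeros : SimpleZerosStep := by
  sorry

/-- **Stub E — transfer to finite `x` by sign alternation at fixed test points.** `TransferStep`. For `u = 2`:
`Negative.realRootedAt_two` (`x₀ = 2`). For `u ≥ 3`: from `ModelSimple u` get `d := u−2 ≥ 1` distinct real roots
`r_1 < … < r_d` of `p := modelPoly u ≠ 0` with `natDegree p ≤ d`, hence `p = lead · ∏ (X − r_i)` with simple roots; pick
`t_0 < r_1 < t_1 < … < r_d < t_d`; then `p(t_i)·p(t_{i+1}) < 0` (factor `p = (X − r_{i+1})·q`, `q` without roots in
`[t_i, t_{i+1}]` hence of one sign there by the IVT); by `CellAsymptotics u` at the finitely many `(j, t_i)`,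
`(log x/x)·(cellPolyQ u x).eval t_i = Σ_{j<u} (A_{j+1}(x) log x/x) t_i^j → Σ_{j<u} I_{j+1}(u) t_i^j = p(t_i)`
(`Negative.cellPolyQ_eval`, `modelPoly_eval`, `tendsto_finset_sum`), so for `x ≥ x₀(u)` the values
`(cellPolyQ u x).eval t_i` alternate strictly (`Tendsto.eventually_const_lt`, `eventually_all`, `log x/x > 0`); conclude by
the LANDED `Negative.realRootedAt_of_alternating` (`natDegree_cellPolyQ_le : deg ≤ u−2 = d`, `0 < d`). Size M. -/
theorem stub_transfer : TransferStep := by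
  sorry

/-- **Stub F — Alladi's cell asymptotics WITH RATE (the labour; held by the lead).** `DensityCalculus → CellRate`
(the calculus hypothesis supplies continuity, vanishing and the FTC derivative of the densities). By induction on `j`
over the tree's Buchstab machinery, carrying all `k`: `j = 0` is `π(X) − π(Y⁻) = X/log X − Y/log Y + O(X/log² Y)`
(PNT with de la Vallée Poussin's error, tree `Literature.NumberTheory.LFunctions`); the step uses the Ω-split of
Buchstab's identity `omegaCell N X (j+2) = omegaCell M X (j+2) + Σ_{N ≤ p < M} omegaCell p (X/p) (j+1)`
(cf. `card_roughIcc_eq_card_add_sum`) at `z = x^{1/k}`, the hypothesis at `(x, z)` and at every `(x/p, p)`, Abel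
summation through `ϑ` (`abs_sum_sub_integral_le_of_weight_bounds`, in the tree) for the weight
`x σ_j(log x/log t − 1)/(t log² t)`, `σ_j(v) = I_{j+1}(v)/v`, and the main-term identity
`∫_y^z x σ_j(log x/log t − 1) dt/(t log² t) = (x/log x)(u σ_{j+1}(u) − k σ_{j+1}(k))` (substitution `v = log x/log t` and
`(v σ_{j+1}(v))' = σ_j(v−1)`, i.e. (C4)). Size L. [Alladi 1982; Tenenbaum III.6; Harman 2007 App. A.2] -/
theorem stub_cellRate : DensityCalculus → CellRate := by
  sorry

/-- **Stub G — rate ⇒ limit at integer roughness.** `CellLimitStep`: for `u ≥ 2` and any `j`, apply `CellRate j (u+1)`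
at `X = x`, `Y = ⌊x^{1/u}⌋₊ + 1` (`cell_eq_omegaCell`; `⌈Y⌉₊ = Y`, `⌊X⌋₊ = x`, `2 ≤ Y ≤ x` and `log x ≤ (u+1) log Y`
eventually), divide by `x/log x`: the error is `≤ C log x/log² Y → 0`, the secondary term `Y log x/(x log Y) → 0`, and
`I_{j+1}(log x/log Y) → I_{j+1}(u)` because `log x/log Y → u` (`Y/x^{1/u} → 1`) and `I_{j+1}` is continuous (C1). Size M. -/
theorem stub_cellLimit : CellLimitStep := by
  sorry

/-- **Stub H — `stub_glue` (registered bookkeeping stub; pure logic, PROVED in the vocabulary file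
`Theorems/LeeYangFibresModelHyperbolicityDefs.lean`, through which that file lands `--supports`).** The six
mathematical stubs compose to the crux in its factored form. -/
theorem stub_glue : DensityCalculus → (DensityCalculus → (∀ N : ℕ, WindowChain N) ∧ NoNullWindow) →
    SimpleZerosStep → TransferStep → CellRate → CellLimitStep →
    ∀ u : ℕ, 2 ≤ u → ∃ x₀ : ℕ, ∀ x : ℕ, x₀ ≤ x → RealRootedAt u x := by
  sorry

/-! ## §2 Composition (sorry-free glue; kernel-checked): the crux BY NAME -/

/-- **THE SKELETON THEOREM**: the seven registered stubs compose to `LeeYangFibres.ModelHyperbolicity` BY NAME —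
`crux_iff.mpr (glue calc windowChain simpleZeros transfer (cellRate calc) cellLimit)`, where `glue` is itself the pure-logic
composition `fun … u hu => transfer u hu (simpleZeros calc wc.1 wc.2 u hu) (cellLimit calc cellRate u hu)`.
No `sorry` of its own; closed exactly when the seven stubs are. -/
theorem ModelHyperbolicity_of : ModelHyperbolicity :=
  crux_iff.mpr
    (stub_glue stub_calculus stub_windowChain stub_simpleZeros stub_transfer (stub_cellRate stub_calculus)
      stub_cellLimit)

/-- The hypothetical form of the composition — pure logic in the seven stub STATEMENTS, no stub used. -/
example : DensityCalculus → (DensityCalculus → (∀ N : ℕ, WindowChain N) ∧ NoNullWindow) →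
    SimpleZerosStep → TransferStep → CellRate → CellLimitStep → ModelHyperbolicity :=
  fun hA hB hD hE hF hG =>
    crux_iff.mpr fun u hu => hE u hu (hD hA (hB hA).1 (hB hA).2 u hu) (hG hA hF u hu)

/-- Checked against the landed Negative lemmas (imported): the `x₀`-guard and `2 ≤ u` are load-bearing for the crux
this skeleton concludes, and `x₀` cannot be uniform in `u` — consistent with `TransferStep` (`∀ u … ∃ x₀`). -/
example : ¬ ModelHyperbolicityWithoutLargeX ∧ ¬ ModelHyperbolicityWithoutTwoLe ∧ ¬ ModelHyperbolicityUniform :=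
  ⟨modelHyperbolicity_false_without_largeX, modelHyperbolicity_false_without_two_le, not_modelHyperbolicityUniform⟩

/-! ## drefute probes (refuter-drefute-stmt-Parity-14110-0) — against the LEAD-RESHAPED skeleton -/
section DrefuteProbes

-- P1 (reshaped 7-stub skeleton of 2026-08-16T01:07Z): each registered stub TYPE elaborates standalone
example : DensityCalculus := by sorry
example : DensityCalculus → (∀ N : ℕ, WindowChain N) ∧ NoNullWindow := by sorry
example : SimpleZerosStep := by sorry
example : TransferStep := by sorry
example : DensityCalculus → CellRate := by sorry
example : CellLimitStep := by sorry

-- P1b: the bookkeeping stub `stub_glue` is pure logic (closed by a term; it is MEANT to be trivial)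
example : DensityCalculus → (DensityCalculus → (∀ N : ℕ, WindowChain N) ∧ NoNullWindow) →
    SimpleZerosStep → TransferStep → CellRate → CellLimitStep →
    ∀ u : ℕ, 2 ≤ u → ∃ x₀ : ℕ, ∀ x : ℕ, x₀ ≤ x → RealRootedAt u x :=
  fun hA hB hD hE hF hG u hu => hE u hu (hD hA (hB hA).1 (hB hA).2 u hu) (hG hA hF u hu)

-- P1c: `CellRate` at k = 0 is vacuous (log X ≤ 0 contradicts X ≥ 2) — harmless degenerate instance
example (j : ℕ) : ∃ C : ℝ, ∀ X Y : ℝ, 2 ≤ Y → Y ≤ X → Real.log X ≤ ((0 : ℕ) : ℝ) * Real.log Y →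
    |(omegaCell ⌈Y⌉₊ ⌊X⌋₊ (j + 1) : ℝ) -
        (X * cellDensity j (Real.log X / Real.log Y) / Real.log X - if j = 0 then Y / Real.log Y else 0)| ≤
      C * X / Real.log Y ^ 2 := by
  refine ⟨0, fun X Y hY hYX hlog => ?_⟩
  exfalso
  have hX : (1 : ℝ) < X := by linarith
  have := Real.log_pos hX
  simp at hlog
  linarith

-- P1d: DensityCalculus boundary instances: (C2) at (j,u) = (0,2), (C3) at j = 0
example : cellDensity 1 2 = 0 := cellDensity_succ_of_le_two 0 le_rfl
example (u : ℝ) : 0 < cellDensity 0 u := by simp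

/-- (re-added by drefute; the reshaped skeleton dropped it) base window: the invariant on `t ≤ 2`. -/
theorem windowChain_base {N : ℕ} (hN : 1 ≤ N) (τ t : ℝ) (_hτ : 1 ≤ τ) (hτt : τ ≤ t) (ht : t ≤ 2)
    (z : ℂ) (hz : 0 < z.im) :
    modelEval N τ z ≠ 0 ∧ modelEval N t z ≠ 0 ∧
      0 ≤ (modelEval N t z / modelEval N τ z).im ∧ 0 < (z * modelEval N τ z / modelEval N t z).im := by
  have hτ2 : τ ≤ 2 := le_trans hτt ht
  rw [modelEval_of_le_two hN hτ2, modelEval_of_le_two hN ht]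
  refine ⟨one_ne_zero, one_ne_zero, ?_, ?_⟩
  · simp
  · simpa using hz

-- P2: degenerate truncations of the lever are vacuous / the base
example : WindowChain 0 := by
  intro τ t h1 h2 h3 h4
  have : (t : ℝ) ≤ 0 := by exact_mod_cast h4
  intro z hz
  exfalso; linarith
example : WindowChain 1 := by
  intro τ t h1 h2 h3 h4 z hz
  exact windowChain_base (N := 1) le_rfl τ t h1 h2 (by have : (t:ℝ) ≤ 1 := (by exact_mod_cast h4); linarith) z hz
example : WindowChain 2 := by
  intro τ t h1 h2 h3 h4 z hz
  exact windowChain_base (N := 2) (by norm_num) τ t h1 h2 (by exact_mod_cast h4) z hz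

-- P3: NoNullWindow — the hypothesis `z ≠ 0` is not needed at z = 0 (G_N(τ;0) = 1)
example (N : ℕ) (a : ℝ) (ha : 1 ≤ a) (hN : a + 1 ≤ N) :
    ∃ τ ∈ Set.Icc a (a + 1), modelEval N τ 0 ≠ 0 := by
  have hN1 : 1 ≤ N := by
    have : (1 : ℝ) + 1 ≤ N := le_trans (by linarith) hN
    exact_mod_cast (by linarith : (1 : ℝ) ≤ N)
  exact ⟨a, ⟨le_rfl, by linarith⟩, by rw [modelEval_zero_right hN1]; exact one_ne_zero⟩

-- P4: ModelSimple at the degenerate u (u - 2 = 0 in ℕ): trivially true, so `2 ≤ u` is decoration in SimpleZerosStep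
example : ModelSimple 0 := by
  refine ⟨?_, by simp⟩
  simp [modelPoly]
example : ModelSimple 1 := by
  refine ⟨?_, by simp⟩
  simp [modelPoly]
example : ModelSimple 2 := by
  refine ⟨?_, by simp⟩
  have h : modelPoly 2 = 1 := by
    simp [modelPoly, Finset.sum_range_succ, cellDensity_succ_of_le_two 0 (le_refl (2:ℝ))]
  rw [h]; simp

-- P5: CellAsymptotics is FALSE at u = 1 (all cells empty, density I_1 = 1): `2 ≤ u` load-bearing in stub 4
example : ¬ CellAsymptotics 1 := by
  intro h
  have h0 := h 0
  have hconst : (fun x : ℕ => (cell 1 x (0 + 1) : ℝ) * Real.log x / x) = fun _ => 0 := by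
    funext x
    simp [Summit.Parity.GeneralizedHardyLittlewood.Theorems.ModelHyperbolicity.Negative.cell_one_eq_zero]
  rw [hconst, cellDensity_zero] at h0
  have := tendsto_nhds_unique h0 tendsto_const_nhds
  norm_num at this

-- P6: read-back of the invariant's sign conventions on an explicit non-constant pair is done numerically
-- (see NOTES); here only: the statement of WindowChain at N = 3 unfolds to G_3(t;z) = 1 + I_2(t) z + I_3(t) z^2.
example (t : ℝ) (z : ℂ) : modelEval 3 t z = 1 + (cellDensity 1 t : ℂ) * z + (cellDensity 2 t : ℂ) * z ^ 2 := by
  simp [modelEval, Finset.sum_range_succ]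

end DrefuteProbes

/-! ## drefute: `WindowChain 3` sorry-free against the skeleton's own definitions
(kernel-level check of the PP/SPP sign conventions on the first non-constant window) -/
section DrefuteWC3

/-- `I_2(u) = log (max (u-1) 1)`. -/
theorem cellDensity_one (u : ℝ) : cellDensity 1 u = Real.log (max (u - 1) 1) := by
  have h1 : (1 : ℝ) ≤ max (u - 1) 1 := le_max_right _ _
  have : cellDensity 1 u = ∫ t in (1 : ℝ)..max (u - 1) 1, t⁻¹ := by
    simp only [cellDensity, one_div]
  rw [this, integral_inv (by
    rw [Set.uIcc_of_le h1]
    intro h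
    have := h.1
    norm_num at this)]
  simp

/-- `I_3(u) = 0` for `u ≤ 3` (the integrand `I_2(t)/t` vanishes on `[1,2]`). -/
theorem cellDensity_two_of_le_three {u : ℝ} (hu : u ≤ 3) : cellDensity 2 u = 0 := by
  have h1 : (1 : ℝ) ≤ max (u - 1) 1 := le_max_right _ _
  have h2 : max (u - 1) 1 ≤ 2 := max_le (by linarith) (by norm_num)
  show (∫ t in (1 : ℝ)..max (u - 1) 1, cellDensity 1 t / t) = 0
  rw [intervalIntegral.integral_congr (g := fun _ => (0 : ℝ)) ?_]
  · simp
  · intro t ht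
    rw [Set.uIcc_of_le h1] at ht
    have ht2 : t ≤ 2 := le_trans ht.2 h2
    have : max (t - 1) 1 = 1 := max_eq_right (by linarith)
    simp [cellDensity_one, this]

/-- On `t ≤ 3`: `G_3(t;z) = 1 + log(max(t-1,1))·z`. -/
theorem modelEval_three {t : ℝ} (ht : t ≤ 3) (z : ℂ) :
    modelEval 3 t z = 1 + (Real.log (max (t - 1) 1) : ℂ) * z := by
  simp [modelEval, Finset.sum_range_succ, cellDensity_one, cellDensity_two_of_le_three ht]

/-- Algebraic core, PP: for `0 ≤ a ≤ b` and `Im z > 0`, `Im((1 + b z)/(1 + a z)) ≥ 0`. -/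
theorem pp_core {a b : ℝ} (ha : 0 ≤ a) (hab : a ≤ b) {z : ℂ} (hz : 0 < z.im) :
    0 ≤ ((1 + (b : ℂ) * z) / (1 + (a : ℂ) * z)).im := by
  have hne : (1 + (a : ℂ) * z) ≠ 0 := by
    intro h
    have him : (1 + (a : ℂ) * z).im = 0 := by rw [h]; simp
    have hre : (1 + (a : ℂ) * z).re = 0 := by rw [h]; simp
    simp at him hre
    rcases him with h0 | h0
    · subst h0; simp at hre
    · linarith
  have hns : 0 < Complex.normSq (1 + (a : ℂ) * z) := Complex.normSq_pos.mpr hne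
  rw [Complex.div_im]
  have key : (1 + (b : ℂ) * z).im * (1 + (a : ℂ) * z).re / Complex.normSq (1 + (a : ℂ) * z) -
      (1 + (b : ℂ) * z).re * (1 + (a : ℂ) * z).im / Complex.normSq (1 + (a : ℂ) * z) =
      z.im * (b - a) / Complex.normSq (1 + (a : ℂ) * z) := by
    field_simp
    simp
    ring
  rw [key]
  exact div_nonneg (mul_nonneg hz.le (sub_nonneg.mpr hab)) hns.le

/-- Algebraic core, SPP: for `0 ≤ a ≤ b` and `Im z > 0`, `Im(z (1 + a z)/(1 + b z)) > 0`. -/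
theorem spp_core {a b : ℝ} (ha : 0 ≤ a) (hab : a ≤ b) {z : ℂ} (hz : 0 < z.im) :
    0 < (z * (1 + (a : ℂ) * z) / (1 + (b : ℂ) * z)).im := by
  have hb : 0 ≤ b := le_trans ha hab
  have hne : (1 + (b : ℂ) * z) ≠ 0 := by
    intro h
    have him : (1 + (b : ℂ) * z).im = 0 := by rw [h]; simp
    have hre : (1 + (b : ℂ) * z).re = 0 := by rw [h]; simp
    simp at him hre
    rcases him with h0 | h0
    · subst h0; simp at hre
    · linarith
  have hns : 0 < Complex.normSq (1 + (b : ℂ) * z) := Complex.normSq_pos.mpr hne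
  rw [Complex.div_im]
  have key : (z * (1 + (a : ℂ) * z)).im * (1 + (b : ℂ) * z).re / Complex.normSq (1 + (b : ℂ) * z) -
      (z * (1 + (a : ℂ) * z)).re * (1 + (b : ℂ) * z).im / Complex.normSq (1 + (b : ℂ) * z) =
      z.im * ((1 + a * z.re) ^ 2 + a * b * z.im ^ 2 + a * (b - a) * z.re ^ 2) /
        Complex.normSq (1 + (b : ℂ) * z) := by
    field_simp
    simp
    ring
  rw [key]
  refine div_pos (mul_pos hz ?_) hns
  rcases eq_or_lt_of_le ha with h0 | hapos
  · subst h0; norm_num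
  · have hbpos : 0 < b := lt_of_lt_of_le hapos hab
    have h3 : 0 < a * b * z.im ^ 2 := by positivity
    nlinarith [sq_nonneg (1 + a * z.re), mul_nonneg hapos.le (mul_nonneg (sub_nonneg.mpr hab) (sq_nonneg z.re))]

/-- **`WindowChain 3`, sorry-free**: the invariant on every pair `1 ≤ τ ≤ t ≤ min(τ+1, 3)`. -/
theorem windowChain_three : WindowChain 3 := by
  intro τ t hτ hτt _ ht z hz
  have ht3 : t ≤ 3 := by exact_mod_cast ht
  have hτ3 : τ ≤ 3 := le_trans hτt ht3
  set a : ℝ := Real.log (max (τ - 1) 1) with ha_def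
  set b : ℝ := Real.log (max (t - 1) 1) with hb_def
  have ha : 0 ≤ a := Real.log_nonneg (le_max_right _ _)
  have hab : a ≤ b := Real.log_le_log (lt_of_lt_of_le one_pos (le_max_right _ _))
    (max_le_max (by linarith) le_rfl)
  rw [modelEval_three hτ3, modelEval_three ht3]
  have hneA : (1 + (a : ℂ) * z) ≠ 0 := by
    intro h
    have him : (1 + (a : ℂ) * z).im = 0 := by rw [h]; simp
    have hre : (1 + (a : ℂ) * z).re = 0 := by rw [h]; simp
    simp at him hre
    rcases him with h0 | h0
    · rw [h0] at hre; simp at hre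
    · linarith
  have hb0 : 0 ≤ b := le_trans ha hab
  have hneB : (1 + (b : ℂ) * z) ≠ 0 := by
    intro h
    have him : (1 + (b : ℂ) * z).im = 0 := by rw [h]; simp
    have hre : (1 + (b : ℂ) * z).re = 0 := by rw [h]; simp
    simp at him hre
    rcases him with h0 | h0
    · rw [h0] at hre; simp at hre
    · linarith
  exact ⟨hneA, hneB, pp_core ha hab hz, spp_core ha hab hz⟩


end DrefuteWC3

/-! ## drefute: TIGHTNESS — the unit window cannot be widened (span 2 fails at N = 4), sorry-free -/
section DrefuteTight

/-- `I_4(u) = 0` for `u ≤ 4`. -/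
theorem cellDensity_three_of_le_four {u : ℝ} (hu : u ≤ 4) : cellDensity 3 u = 0 := by
  have h1 : (1 : ℝ) ≤ max (u - 1) 1 := le_max_right _ _
  have h2 : max (u - 1) 1 ≤ 3 := max_le (by linarith) (by norm_num)
  show (∫ t in (1 : ℝ)..max (u - 1) 1, cellDensity 2 t / t) = 0
  rw [intervalIntegral.integral_congr (g := fun _ => (0 : ℝ)) ?_]
  · simp
  · intro t ht
    rw [Set.uIcc_of_le h1] at ht
    have ht3 : t ≤ 3 := le_trans ht.2 h2
    simp [cellDensity_two_of_le_three ht3]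

/-- The integrand of `I_3` is interval-integrable on `[a,b] ⊆ [1,∞)`. -/
theorem intervalIntegrable_cellDensity_one_div {a b : ℝ} (ha : 1 ≤ a) (hab : a ≤ b) :
    IntervalIntegrable (fun t => cellDensity 1 t / t) MeasureTheory.volume a b := by
  apply ContinuousOn.intervalIntegrable
  rw [Set.uIcc_of_le hab]
  have h1 : Continuous (fun t : ℝ => Real.log (max (t - 1) 1)) :=
    (Continuous.max (continuous_id.sub continuous_const) continuous_const).log
      (fun x => ne_of_gt (lt_of_lt_of_le one_pos (le_max_right _ _)))
  have hfun : (fun t => cellDensity 1 t / t) = fun t => Real.log (max (t - 1) 1) / t := by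
    funext t; rw [cellDensity_one]
  rw [hfun]
  exact h1.continuousOn.div continuousOn_id (fun x hx => by
    have : (1 : ℝ) ≤ x := le_trans ha hx.1
    exact ne_of_gt (by simpa using lt_of_lt_of_le one_pos this))

/-- `I_3(u) > 0` for `u > 3`. -/
theorem cellDensity_two_pos {u : ℝ} (hu : 3 < u) : 0 < cellDensity 2 u := by
  have hm : max (u - 1) 1 = u - 1 := max_eq_left (by linarith)
  show 0 < ∫ t in (1 : ℝ)..max (u - 1) 1, cellDensity 1 t / t
  rw [hm]
  have hint1 := intervalIntegrable_cellDensity_one_div (le_refl (1 : ℝ)) (by norm_num : (1 : ℝ) ≤ 2)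
  have hint2 := intervalIntegrable_cellDensity_one_div (by norm_num : (1 : ℝ) ≤ 2) (by linarith : (2 : ℝ) ≤ u - 1)
  rw [← intervalIntegral.integral_add_adjacent_intervals hint1 hint2]
  have hzero : (∫ t in (1 : ℝ)..2, cellDensity 1 t / t) = 0 := by
    rw [intervalIntegral.integral_congr (g := fun _ => (0 : ℝ)) ?_]
    · simp
    · intro t ht
      rw [Set.uIcc_of_le (by norm_num : (1 : ℝ) ≤ 2)] at ht
      have : max (t - 1) 1 = 1 := max_eq_right (by linarith [ht.2])
      simp [cellDensity_one, this]
  rw [hzero, zero_add]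
  refine intervalIntegral.intervalIntegral_pos_of_pos_on hint2 ?_ (by linarith)
  intro t ht
  have hmax : max (t - 1) 1 = t - 1 := max_eq_left (by linarith [ht.1])
  rw [cellDensity_one, hmax]
  exact div_pos (Real.log_pos (by linarith [ht.1])) (by linarith [ht.1])

/-- The invariant with the window widened to span 2 (everything else as in `WindowChain`). -/
def WindowChainSpanTwo (N : ℕ) : Prop :=
  ∀ τ t : ℝ, 1 ≤ τ → τ ≤ t → t ≤ τ + 2 → t ≤ N → ∀ z : ℂ, 0 < z.im →
    modelEval N τ z ≠ 0 ∧ modelEval N t z ≠ 0 ∧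
      0 ≤ (modelEval N t z / modelEval N τ z).im ∧ 0 < (z * modelEval N τ z / modelEval N t z).im

/-- **TIGHTNESS — the unit window cannot be widened.** With span 2 the invariant fails already at `N = 4`:
witness `τ = 3/2` (`G ≡ 1`), `t = 7/2`, `z = -a/b + i` with `a = I_2(7/2) = log(5/2) > 0`, `b = I_3(7/2) > 0`:
`Im(G_4(t;z)/G_4(τ;z)) = Im(1 + a z + b z²) = a - 2a = -a < 0`, so PP fails. -/
theorem not_windowChainSpanTwo_four : ¬ WindowChainSpanTwo 4 := by
  intro h
  have ha : 0 < cellDensity 1 (7 / 2) := by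
    rw [cellDensity_one]
    exact Real.log_pos (by norm_num)
  have hb : 0 < cellDensity 2 (7 / 2) := cellDensity_two_pos (by norm_num)
  set a : ℝ := cellDensity 1 (7 / 2) with ha_def
  set b : ℝ := cellDensity 2 (7 / 2) with hb_def
  set z : ℂ := ⟨-a / b, 1⟩ with hz_def
  have hz : 0 < z.im := by simp [hz_def]
  obtain ⟨-, -, hPP, -⟩ := h (3 / 2) (7 / 2) (by norm_num) (by norm_num) (by norm_num) (by norm_num) z hz
  have hτ : modelEval 4 (3 / 2) z = 1 := by
    simp [modelEval, Finset.sum_range_succ, cellDensity_succ_of_le_two _ (by norm_num : (3 / 2 : ℝ) ≤ 2)]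
  have ht : modelEval 4 (7 / 2) z = 1 + (a : ℂ) * z + (b : ℂ) * z ^ 2 := by
    simp [modelEval, Finset.sum_range_succ, cellDensity_three_of_le_four (by norm_num : (7 / 2 : ℝ) ≤ 4), ha_def,
      hb_def]
  rw [hτ, ht, div_one] at hPP
  have him : (1 + (a : ℂ) * z + (b : ℂ) * z ^ 2).im = -a := by
    have hb0 : b ≠ 0 := ne_of_gt hb
    simp [hz_def, sq]
    field_simp
    ring
  linarith


end DrefuteTight

end Summit.Parity.GeneralizedHardyLittlewood.Cruxes.ModelHyperbolicity.WindowChainTransport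

end
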